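import Summits.ValiantsHypothesis.ValiantsHypothesis.Theorems.NewtonUnitEquationsTwoProductsTowerRecordLemma
import Summits.ValiantsHypothesis.ValiantsHypothesis.Theorems.NewtonUnitEquationsTwoProductsTowerRecordCells
import Summits.ValiantsHypothesis.ValiantsHypothesis.Theorems.NewtonUnitEquationsTwoProductsMomentRecordCount

/-!
# R13-coeff — AT MOST `2m` RECORD CARRIERS PER CELL; THE TOWER RECORD COUNT AND LAW `(18,2)×(D+1)`

(4/6) K1, second half: ★ `card_cellLettersT_le` — in every cell of the arrangement `{ξ·d = 0} ∪ {ξ·(x_a − x_b + j d) = 0 : |j| ≤ 2mD}` at most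
`2m` carriers occur in records (take `2m+1`, a Siegel dependence `λ`, `ν_b := deg λ_b` if `ξ·d > 0` / `ord λ_b` else, the argmin of
`ψ_b := ξ*·x_b + (L₀ − ν_b)(ξ*·d)`; the tower record lemma refutes it); `record_k` (`k ∈ {kmax S, kmin S}`); candidates per cell `≤ 2(m+1)2^{3m}`;
★ `towerRecordCount`: `#records ≤ 64·(n²(4mD+1)+3)·(m+1)·2^{3m}` — LINEAR in `D`; `arith_tower`; ★★ `towerRecordLaw_holds : TowerRecordLaw`
(`(a,b) = (18,2)`, times `(D+1)`; no sign / dissociation / sparsity hypothesis on the coefficient side).  `card_piAntidiag_le` is the tree's ✓ `…MomentRecordCount` one BY NAME (imported).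
Transplant (val-lit-p3 g18) of val-idea-37 g4's kernel-checked scratch `Cruxes/TwoProducts/TowerRecords_val_idea_37_g4.lean` (rev 3,
sha16 988768bd6d8db99a, ns `ValIdea37g4T`; val-idea-crit-8 g2 VERDICT #19 + addendum: KEEP «R13-coeff», by-name GO for a verbatim transplant);
proofs verbatim by name, docstrings added, namespace = the tree's.  Helper on crux `stmt-ValiantsHypothesis-5906` (`TwoProducts`, line
`relation_ladder`); `--supports`, closes nothing by itself.  HONEST LABEL (crit-8 #19): COEFFICIENT-SIDE; the class rung it feeds (R13, dense
parallel towers on dissociated carriers) is a wider CLASS rung, inert as a hatch; F10's collinear digit towers NOT covered; `ResidualLawV24` ⟺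
`PlanarCellBound`, the crux (stmt-5906), every `closes` binder and every summit statement UNMOVED; VP ≠ VNP is NOT proved.
Credit: mathematics and kernel proofs val-idea-37 g4; critic of record val-idea-crit-8 g2.  No instances, no notation, no named facts. [folklore]
-/

set_option linter.dupNamespace false

noncomputable section

open Classical

namespace Summit.ValiantsHypothesis.ValiantsHypothesis.Theorems.NewtonUnitEquations.TwoProducts.TowerRecord

open scoped BigOperators
open Module Polynomial
open Summit.ValiantsHypothesis.ValiantsHypothesis.Theorems.NewtonUnitEquations.TwoProducts.FormalLogLinearisation
open Summit.ValiantsHypothesis.ValiantsHypothesis.Theorems.NewtonUnitEquations.TwoProducts.MomentRecord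
open Summit.ValiantsHypothesis.ValiantsHypothesis.Theorems.NewtonUnitEquations.TwoProducts.PlanarCell

variable {m n : ℕ}

/-! ## 7. K1, second half: AT MOST `2m` RECORD CARRIERS PER CELL (valued exchange, PROVED) -/

/-- Pencil vectors of the tower model, indexed by the rows of `u` and of `v`. -/
def tvec (γ γ' : Fin m → Fin n → ℂ[X]) (b : Fin n) : Fin m ⊕ Fin m → ℂ[X] :=
  fun i => Sum.elim (fun j => γ j b) (fun j => γ' j b) i

/-- The record letters of a CELL: carriers occurring in some record of some weight of the cell. -/
def cellLettersT (γ γ' : Fin m → Fin n → ℂ[X]) (x : Fin n → Expo) (d : Fin 2 → ℤ) (D m' : ℕ)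
    (κ : (Bool × Bool × Bool × Bool) × ℕ × Bool) : Finset (Fin n) :=
  Finset.univ.filter fun a => ∃ ξ : Fin 2 → ℝ, cellZ (tfam x d (2 * m * D)) ξ = κ ∧
    ∃ (S : Fin n → ℕ) (k : ℕ), IsRecordT γ γ' x d m' ξ (S, k) ∧ 0 < S a

/-- `Σ_b (if b = a then 0 else f b) = Σ_b f b − f a`. [folklore] -/
theorem sum_ite_zero_else {β M : Type*} [Fintype β] [DecidableEq β] [AddCommGroup M] (f : β → M) (a : β) :
    ∑ b, (if b = a then 0 else f b) = ∑ b, f b - f a := by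
  have h1 : ∑ b, (if b = a then 0 else f b) = ∑ b ∈ Finset.univ.erase a, f b := by
    rw [← Finset.sum_erase_add _ _ (Finset.mem_univ a), if_pos rfl, add_zero]
    exact Finset.sum_congr rfl fun b hb => if_neg (Finset.ne_of_mem_erase hb)
  have h2 : ∑ b, f b = ∑ b ∈ Finset.univ.erase a, f b + f a :=
    (Finset.sum_erase_add _ _ (Finset.mem_univ a)).symm
  rw [h1, h2, add_sub_cancel_right]

/-- **≤ 2m record carriers per cell** (uniformly in `n`, `t`, `D`, the layer and the truncation depth `m'`). -/
theorem card_cellLettersT_le (γ γ' : Fin m → Fin n → ℂ[X]) (D : ℕ) (hγ : DegLe γ D) (hγ' : DegLe γ' D)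
    (x : Fin n → Expo) (d : Fin 2 → ℤ) (m' : ℕ) (κ : (Bool × Bool × Bool × Bool) × ℕ × Bool) :
    (cellLettersT γ γ' x d D m' κ).card ≤ 2 * m := by
  by_contra hgt
  rw [not_le] at hgt
  set L₀ := 2 * m * D with hL₀
  obtain ⟨L', hsub, hcardL⟩ := Finset.exists_subset_card_eq
    (show 2 * m + 1 ≤ (cellLettersT γ γ' x d D m' κ).card by omega)
  have hwit : ∀ b ∈ L', ∃ ξ : Fin 2 → ℝ, cellZ (tfam x d L₀) ξ = κ ∧
      ∃ (S : Fin n → ℕ) (k : ℕ), IsRecordT γ γ' x d m' ξ (S, k) ∧ 0 < S b := by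
    intro b hb
    have := hsub hb
    simpa [cellLettersT] using this
  -- Siegel dependence among the `2m+1` pencil vectors of `L'`
  have hdeg : ∀ (b : ↥L') (i : Fin m ⊕ Fin m), (tvec γ γ' (b : Fin n) i).natDegree ≤ D := by
    rintro b (j | j)
    · exact hγ j b
    · exact hγ' j b
  have hcard : Fintype.card (Fin m ⊕ Fin m) * (L₀ + D + 1) < Fintype.card ↥L' * (L₀ + 1) := by
    rw [Fintype.card_sum, Fintype.card_fin, Fintype.card_coe, hcardL, hL₀]
    have : (2 * m + 1) * (2 * m * D + 1) = (m + m) * (2 * m * D + D + 1) + 1 := by ring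
    omega
  obtain ⟨lam, ⟨b₀, hb₀⟩, hdegL, hrelS⟩ :=
    siegel_dependence (ι := Fin m ⊕ Fin m) (κ := ↥L') (fun b => tvec γ γ' (b : Fin n)) D L₀ hdeg hcard
  -- a representative weight of the cell
  obtain ⟨ξs, hξs, -⟩ := hwit b₀ b₀.2
  -- the valuation index `ν` (deg if `ξ·d > 0`, ord otherwise) and the potential `ψ`
  let ν : ↥L' → ℕ := fun b => if 0 < wtZ ξs d then (lam b).natDegree else (lam b).natTrailingDegree
  have hνL : ∀ b, ν b ≤ L₀ := fun b => by
    by_cases h : 0 < wtZ ξs d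
    · simp only [ν, if_pos h]
      exact hdegL b
    · simp only [ν, if_neg h]
      exact (natTrailingDegree_le_natDegree _).trans (hdegL b)
  let ψ : ↥L' → ℝ := fun b => wt ξs (x b) + ((L₀ : ℝ) - ν b) * wtZ ξs d
  obtain ⟨a, haF, hamin⟩ := Finset.exists_min_image (Finset.univ.filter fun b : ↥L' => lam b ≠ 0) ψ
    ⟨b₀, Finset.mem_filter.mpr ⟨Finset.mem_univ _, hb₀⟩⟩
  have ha0 : lam a ≠ 0 := (Finset.mem_filter.mp haF).2
  obtain ⟨ξa, hξa, S, k, hrec, hSa⟩ := hwit a a.2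
  have hcell : cellZ (tfam x d L₀) ξs = cellZ (tfam x d L₀) ξa := hξs.trans hξa.symm
  obtain ⟨hsp, hsn, hsz⟩ := sign_transfer x d L₀ hcell
  -- `(ν_b − s)·(ξ_a·d) ≥ 0` on the support of `λ_b`
  have hνs : ∀ (b : ↥L'), ∀ s ∈ (lam b).support, 0 ≤ ((ν b : ℝ) - s) * wtZ ξa d := by
    intro b s hs
    rcases lt_trichotomy 0 (wtZ ξs d) with hc | hc | hc
    · have hν : ν b = (lam b).natDegree := by simp only [ν, if_pos hc]
      have hle : s ≤ ν b := hν ▸ le_natDegree_of_mem_supp s hs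
      exact mul_nonneg (sub_nonneg.mpr (by exact_mod_cast hle)) (hsp hc).le
    · rw [hsz hc.symm, mul_zero]
    · have hν : ν b = (lam b).natTrailingDegree := by simp only [ν, if_neg (not_lt.mpr hc.le)]
      have hle : ν b ≤ s := hν ▸ natTrailingDegree_le_of_ne_zero (mem_support_iff.mp hs)
      exact mul_nonneg_of_nonpos_of_nonpos (sub_nonpos.mpr (by exact_mod_cast hle)) (hsn hc).le
  -- the relation `λ_a π_a = Σ_{b ≠ a} (−λ_b) π_b`
  let Q : Fin n → ℂ[X] := fun b => if h : b ∈ L' then (if (⟨b, h⟩ : ↥L') = a then 0 else - lam ⟨b, h⟩) else 0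
  have hQsum : ∀ g : Fin n → ℂ[X], (∑ b : ↥L', lam b * g b = 0) → ∑ b, Q b * g b = lam a * g a := by
    intro g hg
    have h1 : ∑ b, Q b * g b = ∑ b ∈ L', Q b * g b := by
      refine (Finset.sum_subset (Finset.subset_univ L') fun b _ hb => ?_).symm
      simp only [Q, dif_neg hb, zero_mul]
    have h2 : ∑ b ∈ L', Q b * g b = ∑ b : ↥L', Q b * g b := (Finset.sum_coe_sort L' _).symm
    have h3 : ∀ b : ↥L', Q b * g b = if b = a then 0 else (-(lam b * g b)) := by
      intro b
      show (if h : (b : Fin n) ∈ L' then (if (⟨b, h⟩ : ↥L') = a then 0 else - lam ⟨b, h⟩) else 0) * g b = _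
      rw [dif_pos b.property]
      simp only [Subtype.coe_eta]
      split_ifs <;> ring
    rw [h1, h2, Finset.sum_congr rfl fun b _ => h3 b, sum_ite_zero_else, Finset.sum_neg_distrib, hg]
    ring
  have hs0 : (lam a).coeff (ν a) ≠ 0 := by
    by_cases hc : 0 < wtZ ξs d
    · have hν : ν a = (lam a).natDegree := by simp only [ν, if_pos hc]
      rw [hν]
      exact leadingCoeff_ne_zero.mpr ha0
    · have hν : ν a = (lam a).natTrailingDegree := by simp only [ν, if_neg hc]
      rw [hν]
      exact fun h => ha0 (trailingCoeff_eq_zero.mp h)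
  have hQa : Q a = 0 := by
    show (if h : (a : Fin n) ∈ L' then (if (⟨a, h⟩ : ↥L') = a then 0 else - lam ⟨a, h⟩) else 0) = 0
    rw [dif_pos a.property]
    simp only [Subtype.coe_eta, if_true]
  have hrel : ∀ j, lam a * γ j a = ∑ b, Q b * γ j b := fun j =>
    (hQsum (fun b => γ j b) (hrelS (Sum.inl j))).symm
  have hrel' : ∀ j, lam a * γ' j a = ∑ b, Q b * γ' j b := fun j =>
    (hQsum (fun b => γ' j b) (hrelS (Sum.inr j))).symm
  have hQ : ∀ b, ∀ s ∈ (Q b).support, 0 ≤ wt ξa (x b) - wt ξa (x a) + ((ν a : ℝ) - s) * wtZ ξa d := by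
    intro b s hs
    by_cases hb : b ∈ L'
    · by_cases hba : (⟨b, hb⟩ : ↥L') = a
      · exfalso
        simp only [Q, dif_pos hb, if_pos hba, support_zero, Finset.notMem_empty] at hs
      · have hQb : Q b = - lam ⟨b, hb⟩ := by simp only [Q, dif_pos hb, if_neg hba]
        rw [hQb, support_neg] at hs
        have hlb : lam ⟨b, hb⟩ ≠ 0 := by
          intro h0
          rw [h0, support_zero] at hs
          exact Finset.notMem_empty _ hs
        have hmin := hamin ⟨b, hb⟩ (Finset.mem_filter.mpr ⟨Finset.mem_univ _, hlb⟩)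
        have hmin' : wt ξs (x a) + ((L₀ : ℝ) - ν a) * wtZ ξs d ≤
            wt ξs (x b) + ((L₀ : ℝ) - ν ⟨b, hb⟩) * wtZ ξs d := hmin
        have he : L₀ + ν a - ν ⟨b, hb⟩ < 2 * L₀ + 1 := by
          have := hνL a
          omega
        have hcast : (((L₀ + ν a - ν ⟨b, hb⟩ : ℕ)) : ℝ) - (L₀ : ℝ) = (ν a : ℝ) - ν ⟨b, hb⟩ := by
          rw [Nat.cast_sub (by have := hνL ⟨b, hb⟩; omega), Nat.cast_add]
          ring
        have h1 : 0 ≤ wtZ ξs (tfam x d L₀ (Sum.inr ((b, (a : Fin n)), ⟨L₀ + ν a - ν ⟨b, hb⟩, he⟩))) := by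
          rw [wtZ_tfam_inr, hcast]
          have e1 : ((L₀ : ℝ) - ν a) * wtZ ξs d = (L₀ : ℝ) * wtZ ξs d - (ν a : ℝ) * wtZ ξs d := by ring
          have e2 : ((L₀ : ℝ) - ν ⟨b, hb⟩) * wtZ ξs d = (L₀ : ℝ) * wtZ ξs d - (ν ⟨b, hb⟩ : ℝ) * wtZ ξs d := by ring
          have e3 : ((ν a : ℝ) - ν ⟨b, hb⟩) * wtZ ξs d = (ν a : ℝ) * wtZ ξs d - (ν ⟨b, hb⟩ : ℝ) * wtZ ξs d := by ring
          linarith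
        have h2 := (nonneg_wtZ_iff_of_cellZ_eq (tfam x d L₀) hcell _).mp h1
        rw [wtZ_tfam_inr, hcast] at h2
        have h3 := hνs ⟨b, hb⟩ s hs
        have hsplit : ((ν a : ℝ) - s) * wtZ ξa d =
            ((ν a : ℝ) - ν ⟨b, hb⟩) * wtZ ξa d + ((ν ⟨b, hb⟩ : ℝ) - s) * wtZ ξa d := by ring
        rw [hsplit]
        linarith
    · exfalso
      simp only [Q, dif_neg hb, support_zero, Finset.notMem_empty] at hs
  exact towerRecordLemma γ γ' x d m' ξa S k hrec a hSa (lam a) Q (ν a) hs0 hQa hrel hrel' (hνs a) hQ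

/-! ## 8. `k` is determined by `S` up to two values; candidates per cell; THE COUNT and THE LAW (PROVED) -/

/-- The live layers `k ≤ D m'` of a carrier multiset `S`. [folklore] -/
def liveLayers (γ γ' : Fin m → Fin n → ℂ[X]) (D m' : ℕ) (S : Fin n → ℕ) : Finset ℕ :=
  (Finset.range (D * m' + 1)).filter fun k => layerT γ γ' k S ≠ 0

/-- The largest live layer of `S` (`0` if none). [folklore] -/
def kmax (γ γ' : Fin m → Fin n → ℂ[X]) (D m' : ℕ) (S : Fin n → ℕ) : ℕ :=
  if h : (liveLayers γ γ' D m' S).Nonempty then (liveLayers γ γ' D m' S).max' h else 0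

/-- The smallest live layer of `S` (`0` if none). [folklore] -/
def kmin (γ γ' : Fin m → Fin n → ℂ[X]) (D m' : ℕ) (S : Fin n → ℕ) : ℕ :=
  if h : (liveLayers γ γ' D m' S).Nonempty then (liveLayers γ γ' D m' S).min' h else 0

/-- A record `(S, k)` has `k = kmax S` (if `ξ·d ≥ 0`) or `k = kmin S` (if `ξ·d < 0`). -/
theorem record_k (γ γ' : Fin m → Fin n → ℂ[X]) (D : ℕ) (hγ : DegLe γ D) (hγ' : DegLe γ' D)
    (x : Fin n → Expo) (d : Fin 2 → ℤ) (m' : ℕ) (ξ : Fin 2 → ℝ) (S : Fin n → ℕ) (k : ℕ)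
    (hrec : IsRecordT γ γ' x d m' ξ (S, k)) : k = kmax γ γ' D m' S ∨ k = kmin γ γ' D m' S := by
  have hlive := hrec.1
  simp only [liveT, Set.mem_setOf_eq] at hlive
  obtain ⟨hsize, hlayer⟩ := hlive
  have hkD : k ≤ D * m' := (le_of_layerT_ne_zero γ γ' D hγ hγ' hlayer).trans (Nat.mul_le_mul_left _ hsize)
  have hkmem : k ∈ liveLayers γ γ' D m' S :=
    Finset.mem_filter.mpr ⟨Finset.mem_range.mpr (by omega), hlayer⟩
  have hne : (liveLayers γ γ' D m' S).Nonempty := ⟨k, hkmem⟩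
  have beat : ∀ k' ∈ liveLayers γ γ' D m' S, k' ≠ k → wtZ ξ (ptZ x d S k') < wtZ ξ (ptZ x d S k) := by
    intro k' hk' hne'
    have hl : (S, k') ∈ liveT γ γ' m' := by
      simp only [liveT, Set.mem_setOf_eq]
      exact ⟨hsize, (Finset.mem_filter.mp hk').2⟩
    exact hrec.2 (S, k') hl (fun h => hne' (congrArg Prod.snd h))
  rcases le_or_gt 0 (wtZ ξ d) with hc | hc
  · left
    rw [kmax, dif_pos hne]
    by_contra hk
    have hle : k ≤ (liveLayers γ γ' D m' S).max' hne := Finset.le_max' _ _ hkmem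
    have hlt : k < (liveLayers γ γ' D m' S).max' hne := lt_of_le_of_ne hle hk
    have hb := beat _ (Finset.max'_mem _ hne) (ne_of_gt hlt)
    rw [wtZ_ptZ_k ξ x d S k, wtZ_ptZ_k ξ x d S ((liveLayers γ γ' D m' S).max' hne)] at hb
    have hcast : (k : ℝ) ≤ (((liveLayers γ γ' D m' S).max' hne : ℕ) : ℝ) := by exact_mod_cast hle
    have := mul_le_mul_of_nonneg_right hcast hc
    linarith
  · right
    rw [kmin, dif_pos hne]
    by_contra hk
    have hle : (liveLayers γ γ' D m' S).min' hne ≤ k := Finset.min'_le _ _ hkmem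
    have hlt : (liveLayers γ γ' D m' S).min' hne < k := lt_of_le_of_ne hle (Ne.symm hk)
    have hb := beat _ (Finset.min'_mem _ hne) (ne_of_lt hlt)
    rw [wtZ_ptZ_k ξ x d S k, wtZ_ptZ_k ξ x d S ((liveLayers γ γ' D m' S).min' hne)] at hb
    have hcast : (((liveLayers γ γ' D m' S).min' hne : ℕ) : ℝ) ≤ k := by exact_mod_cast hle
    have := mul_le_mul_of_nonpos_right hcast hc.le
    linarith

/-- Shallow multisets supported on a letter set. -/
def msets (Lset : Finset (Fin n)) (m' : ℕ) : Finset (Fin n → ℕ) :=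
  (Finset.range (m' + 1)).biUnion fun j => Finset.piAntidiag Lset j

/-- A shallow multiset supported on `Lset` lies in `msets Lset m'`. [folklore] -/
theorem mem_msets {Lset : Finset (Fin n)} {m' : ℕ} {S : Fin n → ℕ} (hS : size S ≤ m')
    (hL : ∀ a, S a ≠ 0 → a ∈ Lset) : S ∈ msets Lset m' := by
  rw [msets, Finset.mem_biUnion]
  refine ⟨Lset.sum S, Finset.mem_range.mpr (Nat.lt_succ_of_le ?_), Finset.mem_piAntidiag.mpr ⟨rfl, hL⟩⟩
  calc Lset.sum S ≤ ∑ i, S i := Finset.sum_le_sum_of_subset (Finset.subset_univ Lset)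
    _ ≤ m' := hS

/-- `|msets Lset m'| ≤ (m'+1)·2^{M+m'}` for `|Lset| ≤ M`. [folklore] -/
theorem card_msets_le (Lset : Finset (Fin n)) (m' M : ℕ) (hL : Lset.card ≤ M) :
    (msets Lset m').card ≤ (m' + 1) * 2 ^ (M + m') := by
  rw [msets]
  calc _ ≤ ∑ j ∈ Finset.range (m' + 1), (Finset.piAntidiag Lset j).card := Finset.card_biUnion_le
    _ ≤ ∑ _j ∈ Finset.range (m' + 1), 2 ^ (M + m') := Finset.sum_le_sum fun j hj => ?_
    _ = (m' + 1) * 2 ^ (M + m') := by rw [Finset.sum_const, Finset.card_range, smul_eq_mul]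
  have hj := Finset.mem_range.mp hj
  exact (card_piAntidiag_le Lset j).trans (Nat.pow_le_pow_right (by norm_num) (by omega))

/-- Candidate records over a letter set: `(S, kmax S)` and `(S, kmin S)`. -/
def candidatesT (γ γ' : Fin m → Fin n → ℂ[X]) (D m' : ℕ) (Lset : Finset (Fin n)) : Finset ((Fin n → ℕ) × ℕ) :=
  (msets Lset m').image (fun S => (S, kmax γ γ' D m' S)) ∪ (msets Lset m').image (fun S => (S, kmin γ γ' D m' S))

/-- `|candidatesT| ≤ 2(m'+1)2^{M+m'}` for `|Lset| ≤ M`. [folklore] -/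
theorem card_candidatesT_le (γ γ' : Fin m → Fin n → ℂ[X]) (D m' M : ℕ) (Lset : Finset (Fin n)) (hL : Lset.card ≤ M) :
    (candidatesT γ γ' D m' Lset).card ≤ 2 * ((m' + 1) * 2 ^ (M + m')) := by
  rw [candidatesT, two_mul]
  exact (Finset.card_union_le _ _).trans (Nat.add_le_add
    (Finset.card_image_le.trans (card_msets_le Lset m' M hL)) (Finset.card_image_le.trans (card_msets_le Lset m' M hL)))

/-- **THE TOWER RECORD COUNT** (coefficient side, `m' = m`): records number `≤ 32 (|TIdx| + 1) · 2 (m+1) 2^{3m}` — linear in `D`. -/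
theorem towerRecordCount (m n D : ℕ) (γ γ' : Fin m → Fin n → ℂ[X]) (hγ : DegLe γ D) (hγ' : DegLe γ' D)
    (x : Fin n → Expo) (d : Fin 2 → ℤ) :
    ((shallowPairsT n m D).filter fun p => ∃ ξ : Fin 2 → ℝ, IsRecordT γ γ' x d m ξ p).card
      ≤ 32 * (2 + n * n * (2 * (2 * m * D) + 1) + 1) * (2 * ((m + 1) * 2 ^ (2 * m + m))) := by
  calc _ ≤ ((cellSetZ (tfam x d (2 * m * D))).biUnion fun κ =>
            candidatesT γ γ' D m (cellLettersT γ γ' x d D m κ)).card := Finset.card_le_card ?_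
    _ ≤ ∑ κ ∈ cellSetZ (tfam x d (2 * m * D)), (candidatesT γ γ' D m (cellLettersT γ γ' x d D m κ)).card :=
        Finset.card_biUnion_le
    _ ≤ ∑ _κ ∈ cellSetZ (tfam x d (2 * m * D)), 2 * ((m + 1) * 2 ^ (2 * m + m)) :=
        Finset.sum_le_sum fun κ _ => card_candidatesT_le γ γ' D m (2 * m) _ (card_cellLettersT_le γ γ' D hγ hγ' x d m κ)
    _ = (cellSetZ (tfam x d (2 * m * D))).card * (2 * ((m + 1) * 2 ^ (2 * m + m))) := by
        rw [Finset.sum_const, smul_eq_mul]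
    _ ≤ 32 * (Fintype.card (TIdx n (2 * m * D)) + 1) * (2 * ((m + 1) * 2 ^ (2 * m + m))) :=
        Nat.mul_le_mul_right _ (card_cellSetZ_le _)
    _ = 32 * (2 + n * n * (2 * (2 * m * D) + 1) + 1) * (2 * ((m + 1) * 2 ^ (2 * m + m))) := by
        rw [card_TIdx]
  rintro ⟨S, k⟩ hp
  rw [Finset.mem_filter] at hp
  obtain ⟨-, ξ, hrec⟩ := hp
  rw [Finset.mem_biUnion]
  refine ⟨cellZ (tfam x d (2 * m * D)) ξ, cellZ_mem_cellSetZ _ ξ, ?_⟩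
  have hlive := hrec.1
  simp only [liveT, Set.mem_setOf_eq] at hlive
  obtain ⟨hsize, -⟩ := hlive
  have hS : S ∈ msets (cellLettersT γ γ' x d D m (cellZ (tfam x d (2 * m * D)) ξ)) m :=
    mem_msets hsize fun a ha => by
      simp only [cellLettersT, Finset.mem_filter, Finset.mem_univ, true_and]
      exact ⟨ξ, rfl, S, k, hrec, Nat.pos_of_ne_zero ha⟩
  rcases record_k γ γ' D hγ hγ' x d m ξ S k hrec with h | h
  · exact Finset.mem_union_left _ (Finset.mem_image.mpr ⟨S, hS, by rw [h]⟩)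
  · exact Finset.mem_union_right _ (Finset.mem_image.mpr ⟨S, hS, by rw [h]⟩)

/-- Lazy arithmetic: the count is `≤ 2^{18 m} (t+2)² (D+1)` for `1 ≤ m`, `n ≤ 2mt`. -/
theorem arith_tower (m n t D : ℕ) (hm : 1 ≤ m) (hn : n ≤ 2 * m * t) :
    32 * (2 + n * n * (2 * (2 * m * D) + 1) + 1) * (2 * ((m + 1) * 2 ^ (2 * m + m)))
      ≤ 2 ^ (18 * m) * (t + 2) ^ 2 * (D + 1) := by
  obtain ⟨X, hX⟩ : ∃ X : ℕ, X = 2 ^ m := ⟨_, rfl⟩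
  have hmX : m + 1 ≤ X := hX ▸ Nat.lt_two_pow_self
  have hX2 : 2 ≤ X := by
    rw [hX]
    calc (2 : ℕ) = 2 ^ 1 := (pow_one 2).symm
      _ ≤ 2 ^ m := Nat.pow_le_pow_right (by norm_num) hm
  have h3 : 2 ^ (2 * m + m) = X ^ 3 := by
    rw [hX, ← pow_mul]
    ring_nf
  have h18 : 2 ^ (18 * m) = X ^ 18 := by rw [hX, ← pow_mul, mul_comm]
  rw [h3, h18]
  have hn' : n ≤ 2 * X * (t + 2) := by
    calc n ≤ 2 * m * t := hn
      _ ≤ 2 * X * (t + 2) := Nat.mul_le_mul (Nat.mul_le_mul_left 2 (by omega)) (by omega)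
  have hmd : m * D ≤ X * D := Nat.mul_le_mul_right _ (by omega)
  have hF : 2 * (2 * m * D) + 1 ≤ 4 * X * (D + 1) := by
    have e1 : 2 * (2 * m * D) = 4 * (m * D) := by ring
    have e2 : 4 * X * (D + 1) = 4 * (X * D) + 4 * X := by ring
    rw [e1, e2]
    omega
  have hA : n * n * (2 * (2 * m * D) + 1) ≤ 16 * (X ^ 3 * (t + 2) ^ 2 * (D + 1)) :=
    calc n * n * (2 * (2 * m * D) + 1) ≤ (2 * X * (t + 2)) * (2 * X * (t + 2)) * (4 * X * (D + 1)) :=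
          Nat.mul_le_mul (Nat.mul_le_mul hn' hn') hF
      _ = 16 * (X ^ 3 * (t + 2) ^ 2 * (D + 1)) := by ring
  have hP : 1 ≤ X ^ 3 * (t + 2) ^ 2 * (D + 1) := Nat.one_le_iff_ne_zero.mpr (by positivity)
  have hB : 2 + n * n * (2 * (2 * m * D) + 1) + 1 ≤ 19 * (X ^ 3 * (t + 2) ^ 2 * (D + 1)) := by omega
  have hC : 2 * ((m + 1) * X ^ 3) ≤ 2 * (X * X ^ 3) := Nat.mul_le_mul_left 2 (Nat.mul_le_mul_right _ hmX)
  have h1216 : 1216 ≤ X ^ 11 :=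
    calc 1216 ≤ 2 ^ 11 := by norm_num
      _ ≤ X ^ 11 := Nat.pow_le_pow_left hX2 11
  calc 32 * (2 + n * n * (2 * (2 * m * D) + 1) + 1) * (2 * ((m + 1) * X ^ 3))
      ≤ 32 * (19 * (X ^ 3 * (t + 2) ^ 2 * (D + 1))) * (2 * (X * X ^ 3)) := Nat.mul_le_mul (Nat.mul_le_mul_left _ hB) hC
    _ = 1216 * (X ^ 7 * (t + 2) ^ 2 * (D + 1)) := by ring
    _ ≤ X ^ 11 * (X ^ 7 * (t + 2) ^ 2 * (D + 1)) := Nat.mul_le_mul_right _ h1216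
    _ = X ^ 18 * (t + 2) ^ 2 * (D + 1) := by ring

/-- **THE TOWER RECORD LAW, PROVED** (`(a, b) = (18, 2)`, times `(D+1)`). -/
theorem towerRecordLaw_holds : TowerRecordLaw := by
  refine ⟨18, 2, fun m n t D γ γ' x d hγ hγ' hn => ?_⟩
  rcases Nat.eq_zero_or_pos m with rfl | hm
  · have h0 : ((shallowPairsT n 0 D).filter fun p => ∃ ξ : Fin 2 → ℝ, IsRecordT γ γ' x d 0 ξ p).card = 0 := by
      rw [Finset.card_eq_zero, Finset.filter_eq_empty_iff]
      rintro p - ⟨ξ, hrec⟩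
      have h := hrec.1
      simp only [liveT, Set.mem_setOf_eq, layerT, momentPolyT] at h
      exact h.2 (by simp)
    rw [h0]
    exact Nat.zero_le _
  · exact (towerRecordCount m n D γ γ' hγ hγ' x d).trans (arith_tower m n t D hm hn)


end Summit.ValiantsHypothesis.ValiantsHypothesis.Theorems.NewtonUnitEquations.TwoProducts.TowerRecord

end
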